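import Summits.QuantumFields.YangMills.Theorems.BalabanUVNodesN15TwoSpacingGluingCurvedKnitCovariantLandauNode
import HarnessLib

/-!
# THE GLUING STEP AT TWO LATTICE SPACINGS — PROGRAMME (P-R), XIV: THE SIX LANDAU-LETTER ROWS FROM THREE CUT-OFF-FREE ROWS, AND NE2⁺ (OPERATOR LAYER) FOR THE FULLY COVARIANT
# FAMILY GIVEN ONE GLOBAL ROW PER GRID FOR `N_V^R` AND ONE FOR ITS TWO-GRID η-DEFECT (dag-n15-c g22, n15-c∕211)

Cell `pub-ymgap`, seat `pub-ymgap-dag-n15-c` (R134 (a); HUMAN RULING D-0062), generation 22.  `bears_on: R4∕N15 · K3⁸ SpineGivenEndpointR13SepCoPHV (stmt-QuantumFields-27366)`.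
Filed `--supports stmt-QuantumFields-27366 --as helper` — COUNT-NEUTRAL.  Theorems only; 0 `sorry`; NO estimate.  Imports BY NAME n15-c∕207 (`ne2PlusOperator_sfqr`) and through it n15-c∕206∕201
(`cvNVr`, `cvNVr'`), 187a (`idef_sandwich_pull`, `hasMaj_sandwich₂_of_abs_le_one`, `cvPsi'_eq_comp`, `one_sub_cvPsi'_eq_comp`, `cvChi'_eq_comp`), 183 (`hasMaj_sandwich_of_abs_le_one`), FILE 114
(`abs_chiCube_le_one`).  n15-c∕187b (`…CovariantAveragingDefectRows`) is the template (it did the same for `N_V^Q`).  Nothing in the tree is modified.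

WHY.  n15-c∕206∕207 display the Landau perturbation letter `N_V^R = ∂Π∂* ⊗ 1 − D_U(I − R(U))D*_U` through SIX rows per cube `□_k` (near `ψ_k N χ_k`, far `(1 − ψ_k) N χ_k`, on both
grids, and the two two-grid η-defects `idef(ψ′Nʹχ′, ψNχ)`).  The cut-offs are block-diagonal multiplications by `|ψ_k|, |1 − ψ_k|, |χ_k| ≤ 1` and the fine ones are pull-backs of the
coarse ones (`χ′_k = χ_k∘π̂`, `ψ′_k = ψ_k∘π̂`), so — exactly as for `N_V^Q` in n15-c∕187b — all six follow from THREE cut-off-free rows: one sharp-block majorant for `N_V^R(U)` on the coarse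
grid, one for `N_V^R(U′)` on the fine grid, and one for the η-defect `idef P̂ P̂ (N_V^R(U′)) (N_V^R(U))`.  This is the form in which any propagator estimate ([B9] (3.49), Lemma 3.3;
sup-norm kernel bounds of [B9] §1) delivers the letters, and it halves the displayed debt of n15-c∕207.

* §1 ★★ `cv_landauRows_of_global` — the six rows of n15-c∕206 (letters `RR` near∕far coarse, `RR′` near∕far fine, `oR` both defects; one rate `δ`) from the three global rows.
* §2 ★★★ `ne2PlusOperator_sfqr_of_global : NE2PlusOperator c₃₅ (sfInstance d mm ι hL) (fun i => sfqrFamily d mm ι a e hL i (E i))` from `hE` (entries 1–3, FILE 132's row) and `hG` = the three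
  global rows ∀ index ∀ class field at one rate `δ_R` (sizes `c_R·c₃₅L^mα₀` one-grid, `C_R·(L^k)^{−γ_R}` two-grid) — n15-c∕207 `ne2PlusOperator_sfqr` fed by §1.

HONEST FRAMING ∕ LIMITS.  Plumbing on MODEL carriers (doubled-torus cover; global small-field gauge); the three global rows are HYPOTHESES (the located next analytic object: sup-norm kernel
rows for the covariant Green function `G′(U)`, its gradient sandwiches and `(Q′G′²Q′*)⁻¹`, [B9] §1∕(3.49) — NOT proved here, nor anywhere in the lane yet); NOT [B9] Thm 3.1∕3.14 as printed
and no estimate of Bałaban's; NE2⁺ NOT PRINTED; N15 of record untouched (DISCHARGED AS CONSUMED, p687738); counts UNMOVED (typed 28∕28 · discharged 8∕27); one finite 𝕋⁴ at fixed ε per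
index — NOT infinite volume ∕ OS ∕ mass gap ∕ Clay.  Restate-immune (no Theses import).
-/

noncomputable section

open scoped BigOperators Matrix

namespace Summit.QuantumFields.YangMills.BalabanUVNodes.N15.Gluing

open Literature.MathematicalPhysics.QuantumFieldTheory.Balaban1983to89
open Literature.MathematicalPhysics.QuantumFieldTheory.Balaban1983to89.B11SectG (BlockNorm HasMaj)
open Literature.MathematicalPhysics.QuantumFieldTheory.Balaban1983to89.T4EtaRateDefect (idef)
open Literature.MathematicalPhysics.QuantumFieldTheory.Balaban1983to89.T4EtaRateCoeffDefect (pull)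
open Literature.MathematicalPhysics.QuantumFieldTheory.Balaban1983to89.B6Prop26Gluing (mulOp mulOp_apply)
open Literature.MathematicalPhysics.QuantumFieldTheory.Balaban1983to89.B6UnitTorusCarrier (unitTorusGeo unitTorusGeo_dist_nonneg)
open Literature.MathematicalPhysics.QuantumFieldTheory.Balaban1983to89.B5Prop11Plancherel (Tor)
open Literature.MathematicalPhysics.QuantumFieldTheory.Balaban1983to89.T4EtaRate (NE2PlusOperator rateFactor)
open Literature.Barriers.QuantumFields (traceForm)
open Summit.QuantumFields.YangMills.BalabanUVNodes.N15.BackgroundLayer (gavgM)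
open Summit.QuantumFields.YangMills.BalabanUVNodes.N15.VectorPiece (kingPrV)
open Summit.QuantumFields.YangMills.BalabanUVNodes.N15.MatrixSpecies (liftBlk liftMap)
open Summit.QuantumFields.YangMills.BalabanUVNodes.N15.OperatorReadout (opGeo)
open Summit.QuantumFields.YangMills.BalabanUVNodes.N15.TwoGrid (abs_chiCube_le_one)

variable {d : ℕ} {L : ℕ} [NeZero L]

/-! ## §1 The six rows from three global rows -/

section Rows

open scoped Matrix.Norms.L2Operator

variable {mm : Type} [Fintype mm] [DecidableEq mm] {ι : Type} [Fintype ι] [DecidableEq ι] (e : Matrix mm mm ℂ ≃L[ℝ] (ι → ℝ)) (mv kk r : ℕ) (hL : Odd L ∧ 1 < L) (a : ℝ)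

/-- ★★ **THE SIX LANDAU-LETTER ROWS OF n15-c∕206 FROM THREE CUT-OFF-FREE ROWS.**  If `N_V^R(U) ≤ RR·e^{−δd}` (coarse sharp blocks), `N_V^R(U′) ≤ RR′·e^{−δd}` (fine blocks `cvBlk∘π̂`) and
`idef P̂ P̂ (N_V^R(U′)) (N_V^R(U)) ≤ oR·e^{−δd}`, then for every cube `□_k`: `ψ_kNχ_k ≤ RR`, `ψ′_kN′χ′_k ≤ RR′`, `idef(ψ′N′χ′, ψNχ) ≤ oR`, `(1−ψ_k)Nχ_k ≤ RR`, `(1−ψ′_k)N′χ′_k ≤ RR′`,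
`idef((1−ψ′)N′χ′, (1−ψ)Nχ) ≤ oR` (all `·e^{−δd}`): the cut-offs are block multiplications by functions bounded by `1`, the fine ones pulled back from the coarse ones.
[cite: Balaban1985BackgroundPropagators, (3.49) p.398, (3.59)–(3.65) pp.402–403 (cut-offs: mechanism), (3.26) p.395] -/
theorem cv_landauRows_of_global {U : Fin (d + 1) → CvX d L mv kk hL → Matrix mm mm ℂ} {U' : Fin (d + 1) → CvX' d L mv kk r hL → Matrix mm mm ℂ} {RR RR' oR δ : ℝ}
    (hRR : 0 ≤ RR) (hRR' : 0 ≤ RR') (hoR : 0 ≤ oR)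
    (hG1 : HasMaj (CvNorm d L mv kk hL ι) (CvNorm d L mv kk hL ι) (cvNVr d L mv kk hL a ι e U) (fun y y' => RR * Real.exp (-(δ * (unitTorusGeo L kk (cvM d L mv kk hL)).dist y y'))))
    (hG2 : HasMaj (BlockNorm.ofBlocks (unitTorusGeo L kk (cvM d L mv kk hL)) (liftBlk (cvBlk d L mv kk hL ∘ (kingPrV L kk r (cvM d L mv kk hL))) ι)) (BlockNorm.ofBlocks (unitTorusGeo L kk (cvM d L mv kk hL)) (liftBlk (cvBlk d L mv kk hL ∘ (kingPrV L kk r (cvM d L mv kk hL))) ι)) (cvNVr' d L mv kk r hL a ι e U') (fun y y' => RR' * Real.exp (-(δ * (unitTorusGeo L kk (cvM d L mv kk hL)).dist y y'))))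
    (hG3 : HasMaj (CvNorm d L mv kk hL ι) (BlockNorm.ofBlocks (unitTorusGeo L kk (cvM d L mv kk hL)) (liftBlk (cvBlk d L mv kk hL ∘ (kingPrV L kk r (cvM d L mv kk hL))) ι)) (idef (pull (liftMap (kingPrV L kk r (cvM d L mv kk hL)) ι)) (pull (liftMap (kingPrV L kk r (cvM d L mv kk hL)) ι)) (cvNVr' d L mv kk r hL a ι e U') (cvNVr d L mv kk hL a ι e U)) (fun y y' => oR * Real.exp (-(δ * (unitTorusGeo L kk (cvM d L mv kk hL)).dist y y')))) :
        (∀ k, HasMaj (CvNorm d L mv kk hL ι) (CvNorm d L mv kk hL ι) (mulOp (fun p : CvX d L mv kk hL × ι => cvPsi d L mv kk hL k p.1) ∘ₗ (cvNVr d L mv kk hL a ι e U) ∘ₗ mulOp (fun p : CvX d L mv kk hL × ι => cvChi d L mv kk hL k p.1)) (fun y y' => RR * Real.exp (-(δ * (unitTorusGeo L kk (cvM d L mv kk hL)).dist y y')))) ∧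
        (∀ k, HasMaj (BlockNorm.ofBlocks (unitTorusGeo L kk (cvM d L mv kk hL)) (liftBlk (cvBlk d L mv kk hL ∘ (kingPrV L kk r (cvM d L mv kk hL))) ι)) (BlockNorm.ofBlocks (unitTorusGeo L kk (cvM d L mv kk hL)) (liftBlk (cvBlk d L mv kk hL ∘ (kingPrV L kk r (cvM d L mv kk hL))) ι)) (mulOp (fun p : CvX' d L mv kk r hL × ι => cvPsi' d L mv kk r hL k p.1) ∘ₗ (cvNVr' d L mv kk r hL a ι e U') ∘ₗ mulOp (fun p : CvX' d L mv kk r hL × ι => cvChi' d L mv kk r hL k p.1)) (fun y y' => RR' * Real.exp (-(δ * (unitTorusGeo L kk (cvM d L mv kk hL)).dist y y')))) ∧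
        (∀ k, HasMaj (CvNorm d L mv kk hL ι) (BlockNorm.ofBlocks (unitTorusGeo L kk (cvM d L mv kk hL)) (liftBlk (cvBlk d L mv kk hL ∘ (kingPrV L kk r (cvM d L mv kk hL))) ι)) (idef (pull (liftMap (kingPrV L kk r (cvM d L mv kk hL)) ι)) (pull (liftMap (kingPrV L kk r (cvM d L mv kk hL)) ι)) (mulOp (fun p : CvX' d L mv kk r hL × ι => cvPsi' d L mv kk r hL k p.1) ∘ₗ (cvNVr' d L mv kk r hL a ι e U') ∘ₗ mulOp (fun p : CvX' d L mv kk r hL × ι => cvChi' d L mv kk r hL k p.1)) (mulOp (fun p : CvX d L mv kk hL × ι => cvPsi d L mv kk hL k p.1) ∘ₗ (cvNVr d L mv kk hL a ι e U) ∘ₗ mulOp (fun p : CvX d L mv kk hL × ι => cvChi d L mv kk hL k p.1))) (fun y y' => oR * Real.exp (-(δ * (unitTorusGeo L kk (cvM d L mv kk hL)).dist y y')))) ∧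
        (∀ k, HasMaj (CvNorm d L mv kk hL ι) (CvNorm d L mv kk hL ι) ((LinearMap.id - mulOp (fun p : CvX d L mv kk hL × ι => cvPsi d L mv kk hL k p.1)) ∘ₗ (cvNVr d L mv kk hL a ι e U) ∘ₗ mulOp (fun p : CvX d L mv kk hL × ι => cvChi d L mv kk hL k p.1)) (fun y y' => RR * Real.exp (-(δ * (unitTorusGeo L kk (cvM d L mv kk hL)).dist y y')))) ∧
        (∀ k, HasMaj (BlockNorm.ofBlocks (unitTorusGeo L kk (cvM d L mv kk hL)) (liftBlk (cvBlk d L mv kk hL ∘ (kingPrV L kk r (cvM d L mv kk hL))) ι)) (BlockNorm.ofBlocks (unitTorusGeo L kk (cvM d L mv kk hL)) (liftBlk (cvBlk d L mv kk hL ∘ (kingPrV L kk r (cvM d L mv kk hL))) ι)) ((LinearMap.id - mulOp (fun p : CvX' d L mv kk r hL × ι => cvPsi' d L mv kk r hL k p.1)) ∘ₗ (cvNVr' d L mv kk r hL a ι e U') ∘ₗ mulOp (fun p : CvX' d L mv kk r hL × ι => cvChi' d L mv kk r hL k p.1)) (fun y y' => RR' * Real.exp (-(δ * (unitTorusGeo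 L kk (cvM d L mv kk hL)).dist y y')))) ∧
        (∀ k, HasMaj (CvNorm d L mv kk hL ι) (BlockNorm.ofBlocks (unitTorusGeo L kk (cvM d L mv kk hL)) (liftBlk (cvBlk d L mv kk hL ∘ (kingPrV L kk r (cvM d L mv kk hL))) ι)) (idef (pull (liftMap (kingPrV L kk r (cvM d L mv kk hL)) ι)) (pull (liftMap (kingPrV L kk r (cvM d L mv kk hL)) ι)) ((LinearMap.id - mulOp (fun p : CvX' d L mv kk r hL × ι => cvPsi' d L mv kk r hL k p.1)) ∘ₗ (cvNVr' d L mv kk r hL a ι e U') ∘ₗ mulOp (fun p : CvX' d L mv kk r hL × ι => cvChi' d L mv kk r hL k p.1)) ((LinearMap.id - mulOp (fun p : CvX d L mv kk hL × ι => cvPsi d L mv kk hL k p.1)) ∘ₗ (cvNVr d L mv kk hL a ι e U) ∘ₗ mulOp (fun p : CvX d L mv kk hL × ι => cvChi d L mv kk hL k p.1))) (fun y y' => oR * Real.exp (-(δ * (unitTorusGeo L kk (cvM d L mv kk hL)).dist y y')))) := by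
  have hχ1 : ∀ (k : Fin (d + 1) → ZMod (2 * L)) (x : CvX d L mv kk hL), |cvChi d L mv kk hL k x| ≤ 1 := fun k x => abs_chiCube_le_one _ x
  have hψ1 : ∀ (k : Fin (d + 1) → ZMod (2 * L)) (x : CvX d L mv kk hL), |cvPsi d L mv kk hL k x| ≤ 1 := fun k x => abs_chiCube_le_one _ x
  have hχ1' : ∀ (k : Fin (d + 1) → ZMod (2 * L)) (x' : CvX' d L mv kk r hL), |cvChi' d L mv kk r hL k x'| ≤ 1 := fun k x' => abs_chiCube_le_one _ x'
  have hψ1' : ∀ (k : Fin (d + 1) → ZMod (2 * L)) (x' : CvX' d L mv kk r hL), |cvPsi' d L mv kk r hL k x'| ≤ 1 := fun k x' => abs_chiCube_le_one _ x'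
  have h1ψ : ∀ (k : Fin (d + 1) → ZMod (2 * L)) (x : CvX d L mv kk hL), |(1 - cvPsi d L mv kk hL k) x| ≤ 1 := fun k x => by
    rw [Pi.sub_apply, Pi.one_apply]; unfold cvPsi TwoGrid.chiCube; split_ifs <;> simp
  have h1ψ' : ∀ (k : Fin (d + 1) → ZMod (2 * L)) (x' : CvX' d L mv kk r hL), |(1 - cvPsi' d L mv kk r hL k) x'| ≤ 1 := fun k x' => by
    rw [Pi.sub_apply, Pi.one_apply]; unfold cvPsi' TwoGrid.chiCube; split_ifs <;> simp
  have hid : ∀ k : Fin (d + 1) → ZMod (2 * L), (LinearMap.id - mulOp (fun p : CvX d L mv kk hL × ι => cvPsi d L mv kk hL k p.1)) =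
      mulOp (fun p : CvX d L mv kk hL × ι => (1 - cvPsi d L mv kk hL k) p.1) := fun k =>
    LinearMap.ext fun f => funext fun p => by simp [mulOp_apply, sub_mul]
  have hid' : ∀ k : Fin (d + 1) → ZMod (2 * L), (LinearMap.id - mulOp (fun p : CvX' d L mv kk r hL × ι => cvPsi' d L mv kk r hL k p.1)) =
      mulOp (fun p : CvX' d L mv kk r hL × ι => (1 - cvPsi' d L mv kk r hL k) p.1) := fun k =>
    LinearMap.ext fun f => funext fun p => by simp [mulOp_apply, sub_mul]
  have hE1 : ∀ y y' : Tor (cvM d L mv kk hL), 0 ≤ RR * Real.exp (-(δ * (unitTorusGeo L kk (cvM d L mv kk hL)).dist y y')) := fun y y' => by positivity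
  have hE2 : ∀ y y' : Tor (cvM d L mv kk hL), 0 ≤ RR' * Real.exp (-(δ * (unitTorusGeo L kk (cvM d L mv kk hL)).dist y y')) := fun y y' => by positivity
  have hE3 : ∀ y y' : Tor (cvM d L mv kk hL), 0 ≤ oR * Real.exp (-(δ * (unitTorusGeo L kk (cvM d L mv kk hL)).dist y y')) := fun y y' => by positivity
  -- coarse one-grid rows, any cuts bounded by one
  have rowC : ∀ (f χ : CvX d L mv kk hL → ℝ), (∀ x, |f x| ≤ 1) → (∀ x, |χ x| ≤ 1) →
      HasMaj (CvNorm d L mv kk hL ι) (CvNorm d L mv kk hL ι) (mulOp (fun p : CvX d L mv kk hL × ι => f p.1) ∘ₗ (cvNVr d L mv kk hL a ι e U) ∘ₗ mulOp (fun p : CvX d L mv kk hL × ι => χ p.1))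
        (fun y y' => RR * Real.exp (-(δ * (unitTorusGeo L kk (cvM d L mv kk hL)).dist y y'))) := fun f χ hf hχ =>
    hasMaj_sandwich_of_abs_le_one (g := unitTorusGeo L kk (cvM d L mv kk hL)) (liftBlk (cvBlk d L mv kk hL) ι) (N := cvNVr d L mv kk hL a ι e U)
      (ψ := fun p : CvX d L mv kk hL × ι => f p.1) (χ := fun p : CvX d L mv kk hL × ι => χ p.1) (fun p => hf p.1) (fun p => hχ p.1) hE1 hG1
  -- fine one-grid rows
  have rowF : ∀ (f' χ' : CvX' d L mv kk r hL → ℝ), (∀ x', |f' x'| ≤ 1) → (∀ x', |χ' x'| ≤ 1) →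
      HasMaj (BlockNorm.ofBlocks (unitTorusGeo L kk (cvM d L mv kk hL)) (liftBlk (cvBlk d L mv kk hL ∘ (kingPrV L kk r (cvM d L mv kk hL))) ι)) (BlockNorm.ofBlocks (unitTorusGeo L kk (cvM d L mv kk hL)) (liftBlk (cvBlk d L mv kk hL ∘ (kingPrV L kk r (cvM d L mv kk hL))) ι)) (mulOp (fun p : CvX' d L mv kk r hL × ι => f' p.1) ∘ₗ (cvNVr' d L mv kk r hL a ι e U') ∘ₗ mulOp (fun p : CvX' d L mv kk r hL × ι => χ' p.1))
        (fun y y' => RR' * Real.exp (-(δ * (unitTorusGeo L kk (cvM d L mv kk hL)).dist y y'))) := fun f' χ' hf hχ =>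
    hasMaj_sandwich_of_abs_le_one (g := unitTorusGeo L kk (cvM d L mv kk hL)) (liftBlk (cvBlk d L mv kk hL ∘ (kingPrV L kk r (cvM d L mv kk hL))) ι) (N := cvNVr' d L mv kk r hL a ι e U')
      (ψ := fun p : CvX' d L mv kk r hL × ι => f' p.1) (χ := fun p : CvX' d L mv kk r hL × ι => χ' p.1) (fun p => hf p.1) (fun p => hχ p.1) hE2 hG2
  -- two-grid rows, fine cuts pulled back from coarse cuts bounded by one
  have rowD : ∀ (f χ : CvX d L mv kk hL → ℝ), (∀ x, |f x| ≤ 1) → (∀ x, |χ x| ≤ 1) →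
      HasMaj (CvNorm d L mv kk hL ι) (BlockNorm.ofBlocks (unitTorusGeo L kk (cvM d L mv kk hL)) (liftBlk (cvBlk d L mv kk hL ∘ (kingPrV L kk r (cvM d L mv kk hL))) ι))
        (idef (pull (liftMap (kingPrV L kk r (cvM d L mv kk hL)) ι)) (pull (liftMap (kingPrV L kk r (cvM d L mv kk hL)) ι))
          (mulOp ((fun p : CvX d L mv kk hL × ι => f p.1) ∘ liftMap (kingPrV L kk r (cvM d L mv kk hL)) ι) ∘ₗ (cvNVr' d L mv kk r hL a ι e U') ∘ₗ
            mulOp ((fun p : CvX d L mv kk hL × ι => χ p.1) ∘ liftMap (kingPrV L kk r (cvM d L mv kk hL)) ι))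
          (mulOp (fun p : CvX d L mv kk hL × ι => f p.1) ∘ₗ (cvNVr d L mv kk hL a ι e U) ∘ₗ mulOp (fun p : CvX d L mv kk hL × ι => χ p.1)))
        (fun y y' => oR * Real.exp (-(δ * (unitTorusGeo L kk (cvM d L mv kk hL)).dist y y'))) := fun f χ hf hχ => by
    rw [idef_sandwich_pull]
    exact hasMaj_sandwich₂_of_abs_le_one (g := unitTorusGeo L kk (cvM d L mv kk hL)) (liftBlk (cvBlk d L mv kk hL) ι) (liftBlk (cvBlk d L mv kk hL ∘ (kingPrV L kk r (cvM d L mv kk hL))) ι)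
      (ψ' := (fun p : CvX d L mv kk hL × ι => f p.1) ∘ liftMap (kingPrV L kk r (cvM d L mv kk hL)) ι) (χ := fun p : CvX d L mv kk hL × ι => χ p.1)
      (fun p => hf _) (fun p => hχ p.1) hE3 hG3
  refine ⟨fun k => rowC _ _ (hψ1 k) (hχ1 k), fun k => rowF _ _ (hψ1' k) (hχ1' k), fun k => ?_, fun k => ?_, fun k => ?_, fun k => ?_⟩
  · rw [cvPsi'_eq_comp, cvChi'_eq_comp]; exact rowD _ _ (hψ1 k) (hχ1 k)
  · rw [hid k]; exact rowC _ _ (h1ψ k) (hχ1 k)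
  · rw [hid' k]; exact rowF _ _ (h1ψ' k) (hχ1' k)
  · rw [hid k, hid' k, one_sub_cvPsi'_eq_comp, cvChi'_eq_comp]; exact rowD _ _ (h1ψ k) (hχ1 k)

end Rows

/-! ## §2 NE2⁺ for the fully covariant family from the three global rows -/

section Node

open scoped Matrix.Norms.L2Operator

variable (d) (mm ι : Type) [Fintype mm] [DecidableEq mm] [Nonempty mm] [Fintype ι] [DecidableEq ι] (e : Matrix mm mm ℂ ≃L[ℝ] (ι → ℝ))

/-- ★★★ **NE2⁺, OPERATOR LAYER, BY NAME, FOR THE GLUED FAMILY WITH BAŁABAN's FULLY COVARIANT SUMMAND LIVE, FROM ONE GLOBAL ROW PER GRID FOR `N_V^R` AND ONE FOR ITS η-DEFECT.**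
n15-c∕207 `ne2PlusOperator_sfqr` with its six-row hypothesis `hR` produced by §1 from `hG`: for every family index and every class-(3.35) field, at one rate `δ_R`,
`N_V^R(U) ≤ c_R·r_A·e^{−δ_Rd}` (coarse), `N_V^R(U′) ≤ c_R·r_A·e^{−δ_Rd}` (fine), `idef P̂ P̂ (N_V^R(U′)) (N_V^R(U)) ≤ C_R·(L^k)^{−γ_R}·e^{−δ_Rd}` (`r_A = c₃₅L^mα₀`).  MODEL family; the three rows
are HYPOTHESES; NOT [B9] Thm 3.1∕3.14 as printed.
[cite: Balaban1985BackgroundPropagators, Thm 3.1 p.397 (quantifier template, (3.42)), (3.25)–(3.26) p.395, (3.49) p.398 (shape of the rows), Thm 3.14 pp.426–427 (difference template); King1986, Prop. 3.9 (3.73) p.665 (rate factor)] -/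
theorem ne2PlusOperator_sfqr_of_global (hL : Odd L ∧ 1 < L) (hL7 : 7 ≤ L) {a : ℝ} (ha : 0 < a) {c35 : ℝ} (hc35 : 0 < c35) (he : ∀ A B : Matrix mm mm ℂ, traceForm A B = e A ⬝ᵥ e B)
    (E : ∀ i : SfIdx d L, Fin 4 → (Fin (d + 1) → CvX' d L i.m i.kk i.r hL → Matrix mm mm ℂ) → ((CvX d L i.m i.kk hL × ι → ℝ) →ₗ[ℝ] (CvX' d L i.m i.kk i.r hL × ι → ℝ)))
    (hE : ∃ M₁ δ₁ a₁ B₁ γ₁ : ℝ, 0 < M₁ ∧ 0 < δ₁ ∧ 0 < a₁ ∧ 0 < B₁ ∧ 0 < γ₁ ∧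
      ∀ i : SfIdx d L, M₁ ≤ (L : ℝ) ^ i.m → ∀ α₀ : ℝ, 0 < α₀ → (L : ℝ) ^ i.m * α₀ ≤ a₁ →
        ∀ A' : Fin (d + 1) → CvX' d L i.m i.kk i.r hL → Matrix mm mm ℂ, (sfInstance d mm ι hL i).Bf.Reg335 c35 α₀ A' → ∀ n : Fin 4, n ≠ 0 →
          HasMaj (BlockNorm.ofBlocks (sfGeo d hL i) (liftBlk (cvBlk d L i.m i.kk hL) ι))
            (BlockNorm.ofBlocks (sfGeo d hL i) (liftBlk (cvBlk d L i.m i.kk hL ∘ kingPrV L i.kk i.r (cvM d L i.m i.kk hL)) ι)) (E i n A')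
            (fun y y' => B₁ * B9.pref4 ((opGeo (sfGeo d hL i) (CvX d L i.m i.kk hL × ι) (liftBlk (cvBlk d L i.m i.kk hL) ι)).len y) n * Real.exp (-(δ₁ * (sfGeo d hL i).dist y y')) *
              max (rateFactor (opGeo (sfGeo d hL i) (CvX d L i.m i.kk hL × ι) (liftBlk (cvBlk d L i.m i.kk hL) ι)) γ₁ y)
                (rateFactor (opGeo (sfGeo d hL i) (CvX d L i.m i.kk hL × ι) (liftBlk (cvBlk d L i.m i.kk hL) ι)) γ₁ y')))
    (hG : ∃ δR cR CR γR : ℝ, 0 < δR ∧ 0 ≤ cR ∧ 0 ≤ CR ∧ 0 < γR ∧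
      ∀ i : SfIdx d L, ∀ α₀ : ℝ, 0 < α₀ → ∀ A' : Fin (d + 1) → CvX' d L i.m i.kk i.r hL → Matrix mm mm ℂ, (sfInstance d mm ι hL i).Bf.Reg335 c35 α₀ A' →
        HasMaj (CvNorm d L i.m i.kk hL ι) (CvNorm d L i.m i.kk hL ι) (cvNVr d L i.m i.kk hL a ι e (fun μ x => NormedSpace.exp (((((L ^ i.kk : ℕ) : ℝ))⁻¹) • gavgM (Matrix mm mm ℂ) (Fin (d + 1)) (kingPrV L i.kk i.r (cvM d L i.m i.kk hL)) A' μ x))) (fun y y' => (cR * (c35 * (L : ℝ) ^ i.m * α₀)) * Real.exp (-(δR * (unitTorusGeo L i.kk (cvM d L i.m i.kk hL)).dist y y'))) ∧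
        HasMaj (BlockNorm.ofBlocks (unitTorusGeo L i.kk (cvM d L i.m i.kk hL)) (liftBlk (cvBlk d L i.m i.kk hL ∘ (kingPrV L i.kk i.r (cvM d L i.m i.kk hL))) ι)) (BlockNorm.ofBlocks (unitTorusGeo L i.kk (cvM d L i.m i.kk hL)) (liftBlk (cvBlk d L i.m i.kk hL ∘ (kingPrV L i.kk i.r (cvM d L i.m i.kk hL))) ι)) (cvNVr' d L i.m i.kk i.r hL a ι e (fun μ x' => NormedSpace.exp (((((L ^ i.r * L ^ i.kk : ℕ) : ℝ))⁻¹) • A' μ x'))) (fun y y' => (cR * (c35 * (L : ℝ) ^ i.m * α₀)) * Real.exp (-(δR * (unitTorusGeo L i.kk (cvM d L i.m i.kk hL)).dist y y'))) ∧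
        HasMaj (CvNorm d L i.m i.kk hL ι) (BlockNorm.ofBlocks (unitTorusGeo L i.kk (cvM d L i.m i.kk hL)) (liftBlk (cvBlk d L i.m i.kk hL ∘ (kingPrV L i.kk i.r (cvM d L i.m i.kk hL))) ι)) (idef (pull (liftMap (kingPrV L i.kk i.r (cvM d L i.m i.kk hL)) ι)) (pull (liftMap (kingPrV L i.kk i.r (cvM d L i.m i.kk hL)) ι)) (cvNVr' d L i.m i.kk i.r hL a ι e (fun μ x' => NormedSpace.exp (((((L ^ i.r * L ^ i.kk : ℕ) : ℝ))⁻¹) • A' μ x'))) (cvNVr d L i.m i.kk hL a ι e (fun μ x => NormedSpace.exp (((((L ^ i.kk : ℕ) : ℝ))⁻¹) • gavgM (Matrix mm mm ℂ) (Fin (d + 1)) (kingPrV L i.kk i.r (cvM d L i.m i.kk hL)) A' μ x)))) (fun y y' => (CR * ((L : ℝ) ^ i.kk) ^ (-γR)) * Real.exp (-(δR * (unitTorusGeo L i.kk (cvM d L i.m i.kk hL)).dist y y')))) :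
    NE2PlusOperator c35 (sfInstance d mm ι hL) (fun i => sfqrFamily d mm ι a e hL i (E i)) := by
  obtain ⟨δR, cR, CR, γR, hδR, hcR, hCR, hγR, hG⟩ := hG
  have hLr : (0 : ℝ) < (L : ℝ) := Nat.cast_pos.mpr (Nat.pos_of_ne_zero (NeZero.ne L))
  refine ne2PlusOperator_sfqr d mm ι e hL hL7 ha hc35 he E hE ⟨δR, cR, CR, γR, hδR, hcR, hCR, hγR, fun i α₀ hα₀ A' hA' => ?_⟩
  obtain ⟨h1, h2, h3⟩ := hG i α₀ hα₀ A' hA'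
  exact cv_landauRows_of_global e i.m i.kk i.r hL a (by positivity) (by positivity) (mul_nonneg hCR (Real.rpow_nonneg (pow_pos hLr _).le _)) h1 h2 h3

end Node

end Summit.QuantumFields.YangMills.BalabanUVNodes.N15.Gluing

end
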